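import Literature.RepresentationTheory.Kovacevic2021.SU21Irreducible
import HarnessLib

/-!
# The lattice of Lie submodules of a Kovačević datum: submodules are the arrow-closed sets of `K`-types

Continuation of `…Kovacevic2021.SU21ModulesFromKTypes` (the `𝔤𝔩(3,ℂ) = 𝔲(2,1)_ℂ`-module
`𝒟.V = ⊕_{(n,m) ∈ S} V_{n,m}` of a datum `𝒟 : SU21Datum` [Kovacevic2021, §3 Def 1, Thm 1, Thm 2]) and of
`…Kovacevic2021.SU21Irreducible` (the criterion `isIrreducible_of_connected`).

Source, verbatim [Kovacevic2021, §3 Remark 2–3, held text `paper:arxiv-1810.01752` p0007]: "`a_{nm}`, `b_{nm}`,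
`c_{nm}` and `d_{nm}` are different from `0` if `V_{nm}` and `V_{n±1,m±3}` are `K` types of an irreducible `(𝔤,K)`
module `V`"; [§3 Remark 6, p0008]: "Reducibility of modules `V(c,2t)` will be obtained when some product(s)
`a_{nm} d_{n+1,m+3}` or `b_{nm} c_{n+1,m-3}` are equal to `0`. … it will be possible to determine if we have a
submodule, quotient or subquotient."  This file makes the submodule structure of an ARBITRARY datum precise: the
Lie submodules of `𝒟.V` correspond, monotonically, to the sets of `K`-types closed under the LIVE arrows.

## What is proved (theorems only; no definitions, no named facts)

For a datum `𝒟 : SU21Datum` and a Lie submodule `N ⊆ 𝒟.V` over `𝔤𝔩(3,ℂ)`: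
* §1 **`N` is spanned by the basis vectors it contains** (`single_mem_of_mem_support`,
  `vec_one_mem_of_mem_support`): with `x ∈ N`, EVERY `u^k_{n,m}` in the support of `x` lies in `N`
  (three Lagrange projections onto the joint eigenvalues of `Z`, `H_α`, `X_α Y_α`, the device of
  `SU21Irreducible.exists_vec_mem_of_ne_zero`); hence the membership criterion `mem_iff_forall_support` (`x ∈ N ↔` every `K`-type met by `supp x` has `u^1 ∈ N`),
  `toSubmodule_eq_supported` (`N =` the finitely supported functions on the labels whose `K`-type `N` meets)
  and `le_iff_forall_vec_one` / `eq_iff_forall_vec_one` (a submodule is determined by the set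
  `R_N = {(n,m) ∈ S : u^1_{n,m} ∈ N}` of `K`-types it meets, monotonically).
* §2 **`R_N` is closed under the live arrows** (`vec_one_mem_of_A_ne_zero`, `…_B_…`, `…_C_…`, `…_D_…`):
  `u^1_{n,m} ∈ N`, `A_{n,m} ≠ 0 ⇒ u^1_{n+1,m+3} ∈ N`, and similarly for `B` (to `(n+1,m-3)`), `C` (to
  `(n-1,m+3)`), `D` (to `(n-1,m-3)`) — the side conditions of `SU21Irreducible.vec_one_mem_C/D` discharged.
* §3 **conversely every arrow-closed set of `K`-types spans a Lie submodule** (`lie_mem_supported_of_closed`,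
  `exists_lieSubmodule_eq_supported`): if `R ⊆ ℤ × ℤ` satisfies `(n,m) ∈ R`, `A_{n,m} ≠ 0`,
  `(n+1,m+3) ∈ S ⇒ (n+1,m+3) ∈ R` and the three analogues, then the functions supported on the labels
  `(n,m,k)` with `(n,m) ∈ R` form a Lie submodule; whence the **reducibility criterion**
  `not_isIrreducible_of_closed` (an arrow-closed `R` meeting `S` but not containing it ⇒ `V` reducible) and
  the characterisation `isIrreducible_iff_closed` (`V` irreducible iff `S ≠ ∅` and every arrow-closed `R`
  meeting `S` contains `S`) — the converse of `SU21Irreducible.isIrreducible_of_connected`.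

The sequel `SU21PrincipalSeriesReducibility` applies this to the principal-series data `V(c,2t)` of
`SU21PrincipalSeriesData` (composition structure, Remark 6; Borel–Wallach VI 4.10 (10)).

## References

* D. Kovačević, *Unitary `(𝔤,K)` modules of `SU(2,1)`*, Acta Math. Spalatensia 1 (2021) 105–125
  (arXiv:1810.01752): §3 Def 1, Thm 1, Thm 2, Remarks 2, 3, 6. [Kovacevic2021]
-/

noncomputable section

open Finsupp Polynomial

namespace Literature.RepresentationTheory.Kovacevic2021

-- Mathlib idiom (Mathlib/Algebra/Lie/OfAssociative.lean): commutator brackets on associative algebras.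
attribute [local instance 100] LieRing.ofAssociativeRing
namespace SU21Datum

variable {𝒟 : SU21Datum}

/-! ## §1 A Lie submodule contains every basis vector in the support of each of its elements -/

/-- Powers of an operator preserve a stable subspace. [folklore] -/
private theorem pow_apply_mem' {W : Submodule ℂ 𝒟.V} {T : Module.End ℂ 𝒟.V} (hW : ∀ v ∈ W, T v ∈ W)
    (n : ℕ) {v : 𝒟.V} (hv : v ∈ W) : (T ^ n) v ∈ W := by
  induction n generalizing v with
  | zero => simpa using hv
  | succ n ih => rw [pow_succ, Module.End.mul_apply]; exact ih (hW v hv)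

/-- Polynomials in an operator preserve a stable subspace. [folklore] -/
private theorem aeval_apply_mem' {W : Submodule ℂ 𝒟.V} {T : Module.End ℂ 𝒟.V} (hW : ∀ v ∈ W, T v ∈ W)
    (p : ℂ[X]) {v : 𝒟.V} (hv : v ∈ W) : aeval T p v ∈ W := by
  induction p using Polynomial.induction_on' with
  | add p q hp hq => rw [map_add, LinearMap.add_apply]; exact W.add_mem hp hq
  | monomial n a =>
    rw [aeval_monomial, Module.End.mul_apply, Module.algebraMap_end_apply]
    exact W.smul_mem a (pow_apply_mem' hW n hv)

/-- Lagrange projection: if `T` is diagonal on the basis `single t 1` with eigenvalues `ev t` and `W` is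
`T`-stable, then with `x ∈ W` also the part of `x` supported where `ev = μ` lies in `W`. [folklore] -/
private theorem filter_mem_of_mem' {W : Submodule ℂ 𝒟.V} {T : Module.End ℂ 𝒟.V} {ev : 𝒟.Idx → ℂ}
    (hT : ∀ t, T (Finsupp.single t 1) = ev t • Finsupp.single t 1) (hW : ∀ v ∈ W, T v ∈ W)
    {x : 𝒟.V} (hx : x ∈ W) (μ : ℂ) :
    Finsupp.filter (fun t => ev t = μ) x ∈ W := by
  classical
  set s : Finset ℂ := x.support.image ev with hs
  set p : ℂ[X] := Lagrange.basis s id μ with hp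
  have hev : ∀ t ∈ x.support, p.eval (ev t) = if ev t = μ then 1 else 0 := by
    intro t ht
    have hts : ev t ∈ s := Finset.mem_image_of_mem ev ht
    split_ifs with h
    · rw [h] at hts ⊢
      exact Lagrange.eval_basis_self (Set.injOn_id _) hts
    · exact Lagrange.eval_basis_of_ne (v := id) (Ne.symm h) hts
  have hsingle : ∀ t, aeval T p (Finsupp.single t 1) = p.eval (ev t) • Finsupp.single t 1 := fun t =>
    Module.End.aeval_apply_of_hasEigenvector
      ⟨Module.End.mem_eigenspace_iff.2 (hT t), Finsupp.single_ne_zero.2 one_ne_zero⟩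
  have hx_sum : x = ∑ t ∈ x.support, x t • Finsupp.single t 1 := by
    conv_lhs => rw [← Finsupp.sum_single x, Finsupp.sum]
    exact Finset.sum_congr rfl fun t _ => by rw [Finsupp.smul_single_one]
  have key : aeval T p x = Finsupp.filter (fun t => ev t = μ) x := by
    rw [hx_sum, map_sum]
    simp_rw [map_smul, hsingle]
    ext a
    simp only [Finsupp.coe_finsetSum, Finset.sum_apply, Finsupp.coe_smul, Pi.smul_apply,
      Finsupp.filter_apply, Finsupp.single_apply, smul_eq_mul, mul_ite, mul_one, mul_zero,
      Finset.sum_ite_eq', Finsupp.mem_support_iff]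
    by_cases ha : x a = 0
    · simp [ha]
    · rw [if_pos ha, hev a (Finsupp.mem_support_iff.2 ha)]
      split_ifs <;> simp
  rw [← key]
  exact aeval_apply_mem' hW p hx

/-- **A Lie submodule contains every basis vector in the support of each of its elements**: if `x ∈ N` and
`u^k_{n,m}` occurs in `x`, then `u^k_{n,m} ∈ N` (project `x` successively onto the eigenvalues of
`Z = H_α + 2H_β`, `H_α`, `X_α Y_α` at the label `(n,m,k)`; the joint eigenvalues `(m, n+1−2k, k(n−k))` separate
the labels). [cite: Kovacevic2021, §3 Thm 2 and Remark 2] -/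
theorem single_mem_of_mem_support (N : LieSubmodule ℂ (Matrix (Fin 3) (Fin 3) ℂ) 𝒟.V) {x : 𝒟.V}
    (hx : x ∈ N) {t : 𝒟.Idx} (ht : t ∈ x.support) : Finsupp.single t 1 ∈ N := by
  classical
  obtain ⟨⟨n₀, m₀, k₀⟩, h₀⟩ := t
  let evZ : 𝒟.Idx → ℂ := fun t => ((t.1.2.1 : ℤ) : ℂ)
  let evH : 𝒟.Idx → ℂ := fun t => ((t.1.1 : ℤ) : ℂ) + 1 - 2 * ((t.1.2.2 : ℤ) : ℂ)
  let evP : 𝒟.Idx → ℂ := fun t => ((t.1.2.2 : ℤ) : ℂ) * (((t.1.1 : ℤ) : ℂ) - ((t.1.2.2 : ℤ) : ℂ))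
  have h1 : Finsupp.filter (fun t => evZ t = evZ ⟨(n₀, m₀, k₀), h₀⟩) x ∈ (N : Submodule ℂ 𝒟.V) :=
    filter_mem_of_mem' (W := (N : Submodule ℂ 𝒟.V)) (T := 𝒟.Ha + (2 : ℂ) • 𝒟.Hb) Z_single
      (fun v hv => by
        rw [LinearMap.add_apply, LinearMap.smul_apply]
        exact N.add_mem (Ha_apply_mem N hv) (N.smul_mem _ (Hb_apply_mem N hv))) hx _
  have h2 := filter_mem_of_mem' (W := (N : Submodule ℂ 𝒟.V)) (T := 𝒟.Ha) Ha_single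
    (fun v hv => Ha_apply_mem N hv) h1 (evH ⟨(n₀, m₀, k₀), h₀⟩)
  have h3 := filter_mem_of_mem' (W := (N : Submodule ℂ 𝒟.V)) (T := 𝒟.Xa * 𝒟.Ya) XaYa_single
    (fun v hv => by rw [Module.End.mul_apply]; exact Xa_apply_mem N (Ya_apply_mem N hv)) h2
    (evP ⟨(n₀, m₀, k₀), h₀⟩)
  -- the triple projection is the single term at `t`
  have hkey : Finsupp.filter (fun t => evP t = evP ⟨(n₀, m₀, k₀), h₀⟩)
      (Finsupp.filter (fun t => evH t = evH ⟨(n₀, m₀, k₀), h₀⟩)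
        (Finsupp.filter (fun t => evZ t = evZ ⟨(n₀, m₀, k₀), h₀⟩) x)) =
      Finsupp.single ⟨(n₀, m₀, k₀), h₀⟩ (x ⟨(n₀, m₀, k₀), h₀⟩) := by
    ext t
    simp only [Finsupp.filter_apply, Finsupp.single_apply]
    by_cases ht : (⟨(n₀, m₀, k₀), h₀⟩ : 𝒟.Idx) = t
    · subst ht; simp
    · rw [if_neg ht]
      obtain ⟨⟨n, m, k⟩, h⟩ := t
      by_cases hP : evP ⟨(n, m, k), h⟩ = evP ⟨(n₀, m₀, k₀), h₀⟩
      · by_cases hH : evH ⟨(n, m, k), h⟩ = evH ⟨(n₀, m₀, k₀), h₀⟩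
        · by_cases hZ : evZ ⟨(n, m, k), h⟩ = evZ ⟨(n₀, m₀, k₀), h₀⟩
          · exfalso
            apply ht
            change ((m : ℤ) : ℂ) = ((m₀ : ℤ) : ℂ) at hZ
            change ((n : ℤ) : ℂ) + 1 - 2 * ((k : ℤ) : ℂ) = ((n₀ : ℤ) : ℂ) + 1 - 2 * ((k₀ : ℤ) : ℂ) at hH
            change ((k : ℤ) : ℂ) * (((n : ℤ) : ℂ) - ((k : ℤ) : ℂ)) =
              ((k₀ : ℤ) : ℂ) * (((n₀ : ℤ) : ℂ) - ((k₀ : ℤ) : ℂ)) at hP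
            have hm : m = m₀ := by exact_mod_cast hZ
            have ha : n + 1 - 2 * k = n₀ + 1 - 2 * k₀ := by exact_mod_cast hH
            have hb : k * (n - k) = k₀ * (n₀ - k₀) := by exact_mod_cast hP
            obtain ⟨rfl, rfl, rfl⟩ := label_injective h.2.1 h.2.2 h₀.2.1 h₀.2.2 hm ha hb
            rfl
          · rw [if_pos hP, if_pos hH, if_neg hZ]
        · rw [if_pos hP, if_neg hH]
      · rw [if_neg hP]
  rw [hkey] at h3
  have hx₀ : x ⟨(n₀, m₀, k₀), h₀⟩ ≠ 0 := Finsupp.mem_support_iff.1 ht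
  have h4 : (x ⟨(n₀, m₀, k₀), h₀⟩)⁻¹ • Finsupp.single (⟨(n₀, m₀, k₀), h₀⟩ : 𝒟.Idx) (x ⟨(n₀, m₀, k₀), h₀⟩)
      ∈ N := N.smul_mem _ h3
  rwa [Finsupp.smul_single, smul_eq_mul, inv_mul_cancel₀ hx₀] at h4

/-- every `u^k_{n,m}` met by the support of some `x ∈ N` lies in `N` [cite: Kovacevic2021, §3 Thm 2, Remark 2] -/
theorem vec_mem_of_mem_support (N : LieSubmodule ℂ (Matrix (Fin 3) (Fin 3) ℂ) 𝒟.V) {x : 𝒟.V}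
    (hx : x ∈ N) {t : 𝒟.Idx} (ht : t ∈ x.support) : 𝒟.vec t.1.1 t.1.2.1 t.1.2.2 ∈ N := by
  obtain ⟨⟨n, m, k⟩, h⟩ := t
  rw [vec_of_pos n m k h]
  exact single_mem_of_mem_support N hx ht

/-- … hence the highest-weight vector `u^1_{n,m}` of that `K`-type lies in `N` [cite: Kovacevic2021, §3 Thm 2] -/
theorem vec_one_mem_of_mem_support (N : LieSubmodule ℂ (Matrix (Fin 3) (Fin 3) ℂ) 𝒟.V) {x : 𝒟.V}
    (hx : x ∈ N) {t : 𝒟.Idx} (ht : t ∈ x.support) : 𝒟.vec t.1.1 t.1.2.1 1 ∈ N :=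
  vec_one_mem_of_vec_mem N t.2 (vec_mem_of_mem_support N hx ht)

/-- **Membership criterion**: `x ∈ N` iff every `K`-type met by the support of `x` has its highest-weight vector
in `N` (a Lie submodule is the sum of the FULL `K`-types `V_{n,m}` it meets — `K`-types have multiplicity one).
[cite: Kovacevic2021, §3 Thm 2 and Remark 2] -/
theorem mem_iff_forall_support (N : LieSubmodule ℂ (Matrix (Fin 3) (Fin 3) ℂ) 𝒟.V) (x : 𝒟.V) :
    x ∈ N ↔ ∀ t ∈ x.support, 𝒟.vec t.1.1 t.1.2.1 1 ∈ N := by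
  refine ⟨fun hx t ht => vec_one_mem_of_mem_support N hx ht, fun h => ?_⟩
  rw [← Finsupp.sum_single x, Finsupp.sum]
  refine Submodule.sum_mem (N : Submodule ℂ 𝒟.V) fun t ht => ?_
  obtain ⟨⟨n, m, k⟩, hk⟩ := t
  rw [← Finsupp.smul_single_one, ← vec_of_pos n m k hk]
  exact N.smul_mem _ (vec_mem_of_vec_one_mem N (h _ ht) k)

/-- **A Lie submodule is the space of functions supported on the labels whose `K`-type it meets.**
[cite: Kovacevic2021, §3 Thm 2 and Remark 2] -/
theorem toSubmodule_eq_supported (N : LieSubmodule ℂ (Matrix (Fin 3) (Fin 3) ℂ) 𝒟.V) :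
    (N : Submodule ℂ 𝒟.V) = Finsupp.supported ℂ ℂ {t : 𝒟.Idx | 𝒟.vec t.1.1 t.1.2.1 1 ∈ N} := by
  ext x
  rw [LieSubmodule.mem_toSubmodule, mem_iff_forall_support, Finsupp.mem_supported]
  rfl

/-- **A Lie submodule is determined, monotonically, by the set of `K`-types it meets**: `N ≤ N'` iff every
`K`-type met by `N` is met by `N'`. [cite: Kovacevic2021, §3 Thm 2 and Remark 2] -/
theorem le_iff_forall_vec_one (N N' : LieSubmodule ℂ (Matrix (Fin 3) (Fin 3) ℂ) 𝒟.V) :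
    N ≤ N' ↔ ∀ n m : ℤ, (n, m) ∈ 𝒟.S → 𝒟.vec n m 1 ∈ N → 𝒟.vec n m 1 ∈ N' := by
  refine ⟨fun h n m _ hv => h hv, fun h x hx => ?_⟩
  rw [mem_iff_forall_support] at hx ⊢
  exact fun t ht => h _ _ t.2.1 (hx t ht)

/-- Two Lie submodules meeting the same `K`-types are equal. [cite: Kovacevic2021, §3 Thm 2 and Remark 2] -/
theorem eq_iff_forall_vec_one (N N' : LieSubmodule ℂ (Matrix (Fin 3) (Fin 3) ℂ) 𝒟.V) :
    N = N' ↔ ∀ n m : ℤ, (n, m) ∈ 𝒟.S → (𝒟.vec n m 1 ∈ N ↔ 𝒟.vec n m 1 ∈ N') := by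
  refine ⟨fun h n m _ => by rw [h], fun h => le_antisymm ?_ ?_⟩
  · exact (le_iff_forall_vec_one N N').2 fun n m hS hv => (h n m hS).1 hv
  · exact (le_iff_forall_vec_one N' N).2 fun n m hS hv => (h n m hS).2 hv

/-! ## §2 The `K`-types of a submodule are closed under the live arrows -/

/-- **Up-move along a live `A`-arrow**: `u^1_{n,m} ∈ N`, `A_{n,m} ≠ 0 ⇒ u^1_{n+1,m+3} ∈ N`.
[cite: Kovacevic2021, §3 Thm 1 and Remark 2] -/
theorem vec_one_mem_of_A_ne_zero (N : LieSubmodule ℂ (Matrix (Fin 3) (Fin 3) ℂ) 𝒟.V) {n m : ℤ}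
    (h1 : 𝒟.vec n m 1 ∈ N) (hA : 𝒟.A n m ≠ 0) : 𝒟.vec (n + 1) (m + 3) 1 ∈ N :=
  vec_one_mem_A N (by by_contra hS; exact hA (𝒟.A_eq_zero hS)) h1 hA

/-- **Up-move along a live `B`-arrow**: `B_{n,m} ≠ 0 ⇒ u^1_{n+1,m-3} ∈ N`. [cite: Kovacevic2021, §3 Thm 1, Remark 2] -/
theorem vec_one_mem_of_B_ne_zero (N : LieSubmodule ℂ (Matrix (Fin 3) (Fin 3) ℂ) 𝒟.V) {n m : ℤ}
    (h1 : 𝒟.vec n m 1 ∈ N) (hB : 𝒟.B n m ≠ 0) : 𝒟.vec (n + 1) (m - 3) 1 ∈ N :=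
  vec_one_mem_B N (by by_contra hS; exact hB (𝒟.B_eq_zero hS)) h1 hB

/-- **Down-move along a live `C`-arrow**: `u^1_{n,m} ∈ N`, `C_{n,m} ≠ 0 ⇒ u^1_{n-1,m+3} ∈ N` (the `A`-term of
`X_β u^1_{n,m}` is already in `N`: either `A_{n,m} = 0` or the whole `K`-type `V_{n+1,m+3} ⊆ N` by the `A`-move).
[cite: Kovacevic2021, §3 Thm 1 and Remark 2] -/
theorem vec_one_mem_of_C_ne_zero (N : LieSubmodule ℂ (Matrix (Fin 3) (Fin 3) ℂ) 𝒟.V) {n m : ℤ}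
    (h1 : 𝒟.vec n m 1 ∈ N) (hC : 𝒟.C n m ≠ 0) : 𝒟.vec (n - 1) (m + 3) 1 ∈ N := by
  refine vec_one_mem_C N h1 hC ?_
  by_cases hA : 𝒟.A n m = 0
  · exact Or.inl hA
  · exact Or.inr (vec_mem_of_vec_one_mem N (vec_one_mem_of_A_ne_zero N h1 hA) 2)

/-- **Down-move along a live `D`-arrow**: `D_{n,m} ≠ 0 ⇒ u^1_{n-1,m-3} ∈ N`. [cite: Kovacevic2021, §3 Thm 1, Remark 2] -/
theorem vec_one_mem_of_D_ne_zero (N : LieSubmodule ℂ (Matrix (Fin 3) (Fin 3) ℂ) 𝒟.V) {n m : ℤ}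
    (h1 : 𝒟.vec n m 1 ∈ N) (hD : 𝒟.D n m ≠ 0) : 𝒟.vec (n - 1) (m - 3) 1 ∈ N := by
  refine vec_one_mem_D N h1 hD ?_
  by_cases hB : 𝒟.B n m = 0
  · exact Or.inl hB
  · exact Or.inr (vec_mem_of_vec_one_mem N (vec_one_mem_of_B_ne_zero N h1 hB) 2)

/-! ## §3 Arrow-closed sets of `K`-types span Lie submodules -/

/-- A multiple of a basis vector whose `K`-type lies in `R` is supported on the labels over `R`. [folklore] -/
private theorem smul_vec_mem_supported {R : Set (ℤ × ℤ)} {n m : ℤ} (c : ℂ) (k : ℤ)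
    (h : c ≠ 0 → (n, m) ∈ 𝒟.S → (n, m) ∈ R) :
    c • 𝒟.vec n m k ∈ Finsupp.supported ℂ ℂ {t : 𝒟.Idx | (t.1.1, t.1.2.1) ∈ R} := by
  by_cases hc : c = 0
  · rw [hc, zero_smul]; exact Submodule.zero_mem _
  by_cases hv : (n, m) ∈ 𝒟.S ∧ 1 ≤ k ∧ k ≤ n
  · rw [vec_of_pos n m k hv]
    exact Submodule.smul_mem _ _ (Finsupp.single_mem_supported ℂ _ (h hc hv.1))
  · rw [vec_of_neg n m k hv, smul_zero]; exact Submodule.zero_mem _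

/-- The action of a matrix on a basis vector `u^k_{n,m}` with `(n,m)` in an ARROW-CLOSED set `R` stays supported
over `R`: the eight operators move `u^k_{n,m}` within `V_{n,m}` or along an arrow, and an arrow leaving `R` has
coefficient `0`. [cite: Kovacevic2021, §3 Thm 1, Remark 2 and Remark 6] -/
theorem lie_vec_mem_supported_of_closed {R : Set (ℤ × ℤ)}
    (hA : ∀ n m : ℤ, (n, m) ∈ R → 𝒟.A n m ≠ 0 → (n + 1, m + 3) ∈ 𝒟.S → (n + 1, m + 3) ∈ R)
    (hB : ∀ n m : ℤ, (n, m) ∈ R → 𝒟.B n m ≠ 0 → (n + 1, m - 3) ∈ 𝒟.S → (n + 1, m - 3) ∈ R)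
    (hC : ∀ n m : ℤ, (n, m) ∈ R → 𝒟.C n m ≠ 0 → (n - 1, m + 3) ∈ 𝒟.S → (n - 1, m + 3) ∈ R)
    (hD : ∀ n m : ℤ, (n, m) ∈ R → 𝒟.D n m ≠ 0 → (n - 1, m - 3) ∈ 𝒟.S → (n - 1, m - 3) ∈ R)
    (M : Matrix (Fin 3) (Fin 3) ℂ) {n m : ℤ} (hR : (n, m) ∈ R) {k : ℤ} (hk : 1 ≤ k) :
    ⁅M, 𝒟.vec n m k⁆ ∈ Finsupp.supported ℂ ℂ {t : 𝒟.Idx | (t.1.1, t.1.2.1) ∈ R} := by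
  set W := Finsupp.supported ℂ ℂ {t : 𝒟.Idx | (t.1.1, t.1.2.1) ∈ R} with hW
  have h0 : ∀ (c : ℂ) (k' : ℤ), c • 𝒟.vec n m k' ∈ W := fun c k' =>
    smul_vec_mem_supported c k' fun _ _ => hR
  have hA' : ∀ (c : ℂ) (k' : ℤ), (c * 𝒟.A n m) • 𝒟.vec (n + 1) (m + 3) k' ∈ W := fun c k' =>
    smul_vec_mem_supported _ k' fun hc hS => hA n m hR (fun h => hc (by rw [h, mul_zero])) hS
  have hB' : ∀ (c : ℂ) (k' : ℤ), (c * 𝒟.B n m) • 𝒟.vec (n + 1) (m - 3) k' ∈ W := fun c k' =>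
    smul_vec_mem_supported _ k' fun hc hS => hB n m hR (fun h => hc (by rw [h, mul_zero])) hS
  have hC' : ∀ (c : ℂ) (k' : ℤ), (c * 𝒟.C n m) • 𝒟.vec (n - 1) (m + 3) k' ∈ W := fun c k' =>
    smul_vec_mem_supported _ k' fun hc hS => hC n m hR (fun h => hc (by rw [h, mul_zero])) hS
  have hD' : ∀ (c : ℂ) (k' : ℤ), (c * 𝒟.D n m) • 𝒟.vec (n - 1) (m - 3) k' ∈ W := fun c k' =>
    smul_vec_mem_supported _ k' fun hc hS => hD n m hR (fun h => hc (by rw [h, mul_zero])) hS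
  rw [lie_def]
  simp only [ρfun, LinearMap.add_apply, LinearMap.smul_apply, Ha_vec, Hb_vec, Xa_vec, Ya_vec n m hk,
    Xab_vec, Xb_vec n m hk, Yab_vec n m hk, Yb_vec, smul_add, smul_smul, smul_neg, ← neg_smul]
  refine W.add_mem (W.add_mem (W.add_mem (W.add_mem (W.add_mem (W.add_mem (W.add_mem (h0 _ _) (h0 _ _))
    (h0 _ _)) (h0 _ _)) (W.add_mem ?_ ?_)) (W.add_mem ?_ ?_)) (W.add_mem ?_ ?_)) (W.add_mem ?_ ?_)
  · have := hA' (-(M 1 2)) (k + 1); rwa [neg_mul, ← mul_neg] at this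
  · exact hC' _ _
  · rw [← mul_assoc]; exact hB' _ _
  · rw [show M 2 1 * -(((k : ℂ) - 1) * 𝒟.D n m) = (-(M 2 1 * ((k : ℂ) - 1))) * 𝒟.D n m by ring]
    exact hD' _ _
  · rw [← mul_assoc]; exact hA' _ _
  · rw [← mul_assoc]; exact hC' _ _
  · exact hB' _ _
  · exact hD' _ _

/-- **An arrow-closed set of `K`-types spans a `𝔤𝔩(3,ℂ)`-stable subspace**: the functions supported on the labels
`(n,m,k)` with `(n,m) ∈ R`. [cite: Kovacevic2021, §3 Remark 2 and Remark 6] -/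
theorem lie_mem_supported_of_closed {R : Set (ℤ × ℤ)}
    (hA : ∀ n m : ℤ, (n, m) ∈ R → 𝒟.A n m ≠ 0 → (n + 1, m + 3) ∈ 𝒟.S → (n + 1, m + 3) ∈ R)
    (hB : ∀ n m : ℤ, (n, m) ∈ R → 𝒟.B n m ≠ 0 → (n + 1, m - 3) ∈ 𝒟.S → (n + 1, m - 3) ∈ R)
    (hC : ∀ n m : ℤ, (n, m) ∈ R → 𝒟.C n m ≠ 0 → (n - 1, m + 3) ∈ 𝒟.S → (n - 1, m + 3) ∈ R)
    (hD : ∀ n m : ℤ, (n, m) ∈ R → 𝒟.D n m ≠ 0 → (n - 1, m - 3) ∈ 𝒟.S → (n - 1, m - 3) ∈ R)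
    (M : Matrix (Fin 3) (Fin 3) ℂ) {v : 𝒟.V} (hv : v ∈ Finsupp.supported ℂ ℂ {t : 𝒟.Idx | (t.1.1, t.1.2.1) ∈ R}) :
    ⁅M, v⁆ ∈ Finsupp.supported ℂ ℂ {t : 𝒟.Idx | (t.1.1, t.1.2.1) ∈ R} := by
  rw [Finsupp.supported_eq_span_single] at hv
  refine Submodule.span_induction (p := fun v _ => ⁅M, v⁆ ∈ _) ?_ (by rw [lie_zero]; exact Submodule.zero_mem _)
    (fun x y _ _ hx hy => by rw [lie_add]; exact Submodule.add_mem _ hx hy)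
    (fun c x _ hx => by rw [lie_smul]; exact Submodule.smul_mem _ c hx) hv
  rintro _ ⟨t, ht, rfl⟩
  obtain ⟨⟨n, m, k⟩, h⟩ := t
  change ⁅M, Finsupp.single (⟨(n, m, k), h⟩ : 𝒟.Idx) 1⁆ ∈ _
  rw [← vec_of_pos n m k h]
  exact lie_vec_mem_supported_of_closed hA hB hC hD M ht h.2.1

/-- **Every arrow-closed set of `K`-types is the `K`-type set of a Lie submodule** (the supported functions).
[cite: Kovacevic2021, §3 Remark 2 and Remark 6] -/
theorem exists_lieSubmodule_eq_supported {R : Set (ℤ × ℤ)}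
    (hA : ∀ n m : ℤ, (n, m) ∈ R → 𝒟.A n m ≠ 0 → (n + 1, m + 3) ∈ 𝒟.S → (n + 1, m + 3) ∈ R)
    (hB : ∀ n m : ℤ, (n, m) ∈ R → 𝒟.B n m ≠ 0 → (n + 1, m - 3) ∈ 𝒟.S → (n + 1, m - 3) ∈ R)
    (hC : ∀ n m : ℤ, (n, m) ∈ R → 𝒟.C n m ≠ 0 → (n - 1, m + 3) ∈ 𝒟.S → (n - 1, m + 3) ∈ R)
    (hD : ∀ n m : ℤ, (n, m) ∈ R → 𝒟.D n m ≠ 0 → (n - 1, m - 3) ∈ 𝒟.S → (n - 1, m - 3) ∈ R) :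
    ∃ N : LieSubmodule ℂ (Matrix (Fin 3) (Fin 3) ℂ) 𝒟.V,
      (N : Submodule ℂ 𝒟.V) = Finsupp.supported ℂ ℂ {t : 𝒟.Idx | (t.1.1, t.1.2.1) ∈ R} :=
  ⟨{ Finsupp.supported ℂ ℂ {t : 𝒟.Idx | (t.1.1, t.1.2.1) ∈ R} with
      lie_mem := fun hv => lie_mem_supported_of_closed hA hB hC hD _ hv }, rfl⟩

/-- Basis vectors in a supported subspace: `u^k_{n,m}` (an admissible label) is supported over `R` iff
`(n,m) ∈ R`. [cite: Kovacevic2021, §3 Def 1] -/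
theorem vec_mem_supported_iff {R : Set (ℤ × ℤ)} {n m k : ℤ} (h : (n, m) ∈ 𝒟.S ∧ 1 ≤ k ∧ k ≤ n) :
    𝒟.vec n m k ∈ Finsupp.supported ℂ ℂ {t : 𝒟.Idx | (t.1.1, t.1.2.1) ∈ R} ↔ (n, m) ∈ R := by
  rw [vec_of_pos n m k h, Finsupp.mem_supported, Finsupp.support_single _ one_ne_zero,
    Finset.coe_singleton, Set.singleton_subset_iff]
  rfl

/-- **Reducibility criterion**: an arrow-closed set `R` of `K`-types containing SOME but not ALL `K`-types of the
datum exhibits a proper non-zero Lie submodule, so `V` is reducible.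
[cite: Kovacevic2021, §3 Remark 2 and Remark 6] -/
theorem not_isIrreducible_of_closed {R : Set (ℤ × ℤ)}
    (hA : ∀ n m : ℤ, (n, m) ∈ R → 𝒟.A n m ≠ 0 → (n + 1, m + 3) ∈ 𝒟.S → (n + 1, m + 3) ∈ R)
    (hB : ∀ n m : ℤ, (n, m) ∈ R → 𝒟.B n m ≠ 0 → (n + 1, m - 3) ∈ 𝒟.S → (n + 1, m - 3) ∈ R)
    (hC : ∀ n m : ℤ, (n, m) ∈ R → 𝒟.C n m ≠ 0 → (n - 1, m + 3) ∈ 𝒟.S → (n - 1, m + 3) ∈ R)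
    (hD : ∀ n m : ℤ, (n, m) ∈ R → 𝒟.D n m ≠ 0 → (n - 1, m - 3) ∈ 𝒟.S → (n - 1, m - 3) ∈ R)
    {n m : ℤ} (hS : (n, m) ∈ 𝒟.S) (hR : (n, m) ∈ R) {n' m' : ℤ} (hS' : (n', m') ∈ 𝒟.S)
    (hR' : (n', m') ∉ R) : ¬ LieModule.IsIrreducible ℂ (Matrix (Fin 3) (Fin 3) ℂ) 𝒟.V := by
  obtain ⟨N, hN⟩ := exists_lieSubmodule_eq_supported hA hB hC hD
  intro hirr
  have h1 : 𝒟.vec n m 1 ∈ N := by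
    rw [← LieSubmodule.mem_toSubmodule, hN]
    exact (vec_mem_supported_iff ⟨hS, le_rfl, 𝒟.one_le_of_mem hS⟩).2 hR
  have h2 : 𝒟.vec n' m' 1 ∉ N := by
    rw [← LieSubmodule.mem_toSubmodule, hN]
    exact fun h => hR' ((vec_mem_supported_iff ⟨hS', le_rfl, 𝒟.one_le_of_mem hS'⟩).1 h)
  haveI := hirr
  rcases IsSimpleOrder.eq_bot_or_eq_top N with h | h
  · rw [h, LieSubmodule.mem_bot] at h1
    exact vec_ne_zero ⟨hS, le_rfl, 𝒟.one_le_of_mem hS⟩ h1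
  · rw [h] at h2
    exact h2 (LieSubmodule.mem_top _)

/-- **Characterisation of irreducibility**: `𝒟.V` is an irreducible `𝔤𝔩(3,ℂ)`-module iff it has a `K`-type and
every arrow-closed set of `K`-types meeting `S` contains `S` (equivalently: the graph of LIVE arrows on `S` is
connected in the sense of `SU21Irreducible.isIrreducible_of_connected`).
[cite: Kovacevic2021, §3 Thm 2, Remark 2 and Remark 6] -/
theorem isIrreducible_iff_closed :
    LieModule.IsIrreducible ℂ (Matrix (Fin 3) (Fin 3) ℂ) 𝒟.V ↔
      𝒟.S.Nonempty ∧ ∀ R : Set (ℤ × ℤ),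
        (∀ n m : ℤ, (n, m) ∈ R → 𝒟.A n m ≠ 0 → (n + 1, m + 3) ∈ 𝒟.S → (n + 1, m + 3) ∈ R) →
        (∀ n m : ℤ, (n, m) ∈ R → 𝒟.B n m ≠ 0 → (n + 1, m - 3) ∈ 𝒟.S → (n + 1, m - 3) ∈ R) →
        (∀ n m : ℤ, (n, m) ∈ R → 𝒟.C n m ≠ 0 → (n - 1, m + 3) ∈ 𝒟.S → (n - 1, m + 3) ∈ R) →
        (∀ n m : ℤ, (n, m) ∈ R → 𝒟.D n m ≠ 0 → (n - 1, m - 3) ∈ 𝒟.S → (n - 1, m - 3) ∈ R) →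
        (∃ p ∈ R, p ∈ 𝒟.S) → 𝒟.S ⊆ R := by
  constructor
  · intro hirr
    refine ⟨?_, fun R hA hB hC hD ⟨⟨n, m⟩, hR, hS⟩ => ?_⟩
    · -- an irreducible module is non-trivial, so some `K`-type occurs
      by_contra hS
      rw [Set.not_nonempty_iff_eq_empty] at hS
      haveI := hirr
      have hbt : (⊥ : LieSubmodule ℂ (Matrix (Fin 3) (Fin 3) ℂ) 𝒟.V) ≠ ⊤ := bot_ne_top
      apply hbt
      rw [← LieSubmodule.toSubmodule_inj, LieSubmodule.bot_toSubmodule, LieSubmodule.top_toSubmodule,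
        eq_comm, ← iSup_Ktype, iSup_eq_bot]
      rintro ⟨n, m⟩
      exact Ktype_eq_bot (by rw [hS]; exact Set.notMem_empty _)
    · rintro ⟨n', m'⟩ hS'
      by_contra hR'
      exact not_isIrreducible_of_closed hA hB hC hD hS hR hS' hR' hirr
  · rintro ⟨⟨⟨n₀, m₀⟩, h₀⟩, h⟩
    refine isIrreducible_of_connected h₀ fun N n m hS h1 n' m' hS' => ?_
    -- the `K`-types met by `N` form an arrow-closed set containing `(n,m)`
    have hsub := h {p : ℤ × ℤ | 𝒟.vec p.1 p.2 1 ∈ N}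
      (fun n m hR hA _ => vec_one_mem_of_A_ne_zero N hR hA)
      (fun n m hR hB _ => vec_one_mem_of_B_ne_zero N hR hB)
      (fun n m hR hC _ => vec_one_mem_of_C_ne_zero N hR hC)
      (fun n m hR hD _ => vec_one_mem_of_D_ne_zero N hR hD) ⟨(n, m), h1, hS⟩
    exact hsub hS'

end SU21Datum

end Literature.RepresentationTheory.Kovacevic2021
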